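import Literature.Analysis.FluidPDE.OseenSlice
import Literature.Analysis.FluidPDE.NSBoundedMildOseen
import HarnessLib

/-!
# Differentiating the Oseen–Duhamel term under the time integral

Analysis/FluidPDE support file (everything proved; no definitions, no named facts) on the proof
path of the corrected perturbation theorem of M. P. Coiculescu, S. Palasek, Invent. Math. 244
(2025), arXiv:2503.14699, Props. 4.2–4.3 (hypothesis `hB`, `κ ≤ α`, of
`Literature.Barriers.NavierStokesRegularity.CoiculescuPalasek2025_construction_of_parts'`). The
`𝒞^{1,κ}` slot of the norm `‖·‖_X` of Prop. 4.3 is a statement about the spatial derivative of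
Duhamel terms `B(u,v)(t) = ∫_{(0,t)} N_{t-τ}[u(τ), v(τ)] dτ` (`oseenDuhamel 1 0 u v t`,
`N_σ = oseenSlice σ`), obtained in the paper by moving `∇` and Hölder differences inside the
time integral (proof of Prop. 4.2, terms I–III; proof of Prop. 4.3). This file justifies that
step for the tree's kernel realisation: dominated differentiation under the integral sign, with
the slice-level bounds supplied as hypotheses (they are proved in `OseenSlice.lean`,
`OseenSliceHolderSeminorm.lean`, `OseenSliceHolderTwoConstant.lean`).

* `measurable_fderiv_of_measurable_uncurry` — if `(τ, x) ↦ g τ x` is jointly measurable and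
  every `g τ` is differentiable at `x₀`, then `τ ↦ D(g τ)(x₀)` is measurable (directional
  derivatives are sequential limits of measurable difference quotients, `HasFDerivAt.lim`; a
  continuous linear map on a finite-dimensional space is determined by its values on a basis,
  `Module.Basis.constr`). No continuity in `τ` is assumed (Mathlib's
  `measurable_fderiv_with_param`-type results need joint continuity).
* `hasFDerivAt_oseenDuhamel` — if the slices of `u, v` are bounded and measurable, the time
  integrand is dominated, and `‖D N_{t-τ}[u(τ),v(τ)](x)‖ ≤ bound(τ)` with `bound` integrable on
  `(0,t)`, then `x ↦ B(u,v)(t)(x)` has the derivative `∫_{(0,t)} D N_{t-τ}[u(τ),v(τ)](x₀) dτ` at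
  every `x₀`; `norm_fderiv_oseenDuhamel_le`, `norm_fderiv_oseenDuhamel_sub_le` — the sup and
  Hölder bounds of this derivative from slice-level bounds; `norm_oseenDuhamel_sub_le` — the
  Hölder modulus of `B(u,v)(t)` itself.

## References

* M. P. Coiculescu, S. Palasek, Invent. Math. 244 (2025) = arXiv:2503.14699, proofs of Props.
  4.2–4.3. [CoiculescuPalasek2025]
* G. Koch, N. Nadirashvili, G. Seregin, V. Šverák, Acta Math. 203 (2009) = arXiv:0709.3599v1,
  §3 (3.12) ("taking difference quotients"). [KochNadirashviliSereginSverak2009]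
-/

noncomputable section

open MeasureTheory Set Function Filter Metric Real
open _root_.Topology
open scoped ENNReal NNReal RealInnerProductSpace ContDiff

namespace Literature.Analysis.FluidPDE

/-! ### Measurability of derivatives of a measurable family -/

section MeasurableFDeriv

variable {α : Type*} [MeasurableSpace α]
variable {V : Type*} [NormedAddCommGroup V] [NormedSpace ℝ V] [FiniteDimensional ℝ V]
  [MeasurableSpace V]
variable {W : Type*} [NormedAddCommGroup W] [NormedSpace ℝ W] [FiniteDimensional ℝ W]
  [MeasurableSpace W] [BorelSpace W]

omit [FiniteDimensional ℝ V] in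
/-- **Directional derivatives of a jointly measurable family are measurable in the parameter**:
if `(τ, x) ↦ g τ x` is measurable and each `g τ` is differentiable at `x₀`, then
`τ ↦ D(g τ)(x₀) v` is measurable (`D(g τ)(x₀)v = lim n(g τ (x₀ + v/n) - g τ x₀)`). [folklore] -/
theorem measurable_fderiv_apply_of_measurable_uncurry {g : α → V → W}
    (hg : Measurable (uncurry g)) {x₀ : V} (hd : ∀ τ, DifferentiableAt ℝ (g τ) x₀) (v : V) :
    Measurable fun τ => fderiv ℝ (g τ) x₀ v := by
  set f : ℕ → α → W := fun n τ => (n : ℝ) • (g τ (x₀ + ((n : ℝ))⁻¹ • v) - g τ x₀) with hf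
  have hfm : ∀ n, Measurable (f n) := by
    intro n
    have h1 : Measurable fun τ => g τ (x₀ + ((n : ℝ))⁻¹ • v) :=
      hg.comp (measurable_id.prodMk measurable_const)
    have h2 : Measurable fun τ => g τ x₀ := hg.comp (measurable_id.prodMk measurable_const)
    exact (h1.sub h2).const_smul _
  have hlim : Tendsto f atTop (𝓝 fun τ => fderiv ℝ (g τ) x₀ v) := by
    rw [tendsto_pi_nhds]
    intro τ
    have hc : Tendsto (fun n : ℕ => ‖((n : ℝ))‖) atTop atTop := by
      simpa using tendsto_natCast_atTop_atTop
    exact (hd τ).hasFDerivAt.lim v hc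
  exact measurable_of_tendsto_metrizable hfm hlim

/-- **The derivative of a jointly measurable family is measurable in the parameter** (as a map
into `V →L[ℝ] W`, finite-dimensional spaces): a continuous linear map is the image of its values
on a basis under a continuous linear reconstruction map (`Module.Basis.constr`), and those values
are measurable by `measurable_fderiv_apply_of_measurable_uncurry`. [folklore] -/
theorem measurable_fderiv_of_measurable_uncurry {g : α → V → W} (hg : Measurable (uncurry g))
    {x₀ : V} (hd : ∀ τ, DifferentiableAt ℝ (g τ) x₀) :
    Measurable fun τ => fderiv ℝ (g τ) x₀ := by
  set b := Module.finBasis ℝ V with hb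
  -- reconstruction of a continuous linear map from its values on the basis
  set Θ : (Fin (Module.finrank ℝ V) → W) ≃ₗ[ℝ] (V →L[ℝ] W) :=
    (b.constr ℝ).trans LinearMap.toContinuousLinearMap with hΘ
  have hΘc : Continuous Θ := Θ.toLinearMap.continuous_of_finiteDimensional
  have hrec : ∀ L : V →L[ℝ] W, Θ (fun i => L (b i)) = L := by
    intro L
    simp only [hΘ, LinearEquiv.trans_apply]
    have h := b.constr_self (S := ℝ) (L : V →ₗ[ℝ] W)
    apply ContinuousLinearMap.coe_injective
    rw [LinearMap.coe_toContinuousLinearMap]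
    exact h
  have hcomp : (fun τ => fderiv ℝ (g τ) x₀) = fun τ => Θ (fun i => fderiv ℝ (g τ) x₀ (b i)) := by
    funext τ; rw [hrec]
  rw [hcomp]
  refine hΘc.measurable.comp ?_
  exact measurable_pi_iff.2 fun i => measurable_fderiv_apply_of_measurable_uncurry hg hd (b i)

end MeasurableFDeriv

/-! ### The Duhamel term: integrability, derivative, Hölder bounds -/

section Duhamel

variable {E : Type*} [NormedAddCommGroup E] [InnerProductSpace ℝ E] [FiniteDimensional ℝ E]
  [MeasurableSpace E] [BorelSpace E]

/-- **The time integrand is integrable when dominated** (slice bound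
`‖N_σ[a,b]‖ ≤ C₀σ^{-1/2}M_aM_b`): if `‖u(τ)‖ ≤ M_u(τ)`, `‖v(τ)‖ ≤ M_v(τ)` on `(s, t)` and
`(t-τ)^{-1/2}M_u(τ)M_v(τ)` is integrable there, then so is `τ ↦ N_{t-τ}[u(τ), v(τ)](x)`. [folklore] -/
theorem integrableOn_oseenSlice_of_dominated {u v : ℝ → E → E} (hum : Measurable (uncurry u))
    (hvm : Measurable (uncurry v)) {s t : ℝ} {Mu Mv : ℝ → ℝ}
    (hu : ∀ τ ∈ Ioo s t, ∀ y, ‖u τ y‖ ≤ Mu τ) (hv : ∀ τ ∈ Ioo s t, ∀ y, ‖v τ y‖ ≤ Mv τ)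
    (hdom : IntegrableOn (fun τ => (t - τ) ^ (-(1 / 2 : ℝ)) * (Mu τ * Mv τ)) (Ioo s t) volume)
    (x : E) :
    IntegrableOn (fun τ => oseenSlice (1 * (t - τ)) (u τ) (v τ) x) (Ioo s t) volume := by
  obtain ⟨C₀, hC₀, hN⟩ := exists_norm_oseenSlice_le (E := E)
  have hmeas : AEStronglyMeasurable (fun τ => oseenSlice (1 * (t - τ)) (u τ) (v τ) x)
      (volume.restrict (Ioo s t)) :=
    ((stronglyMeasurable_oseenSlice_duhamel 1 t hum hvm).comp_measurable
      (measurable_id.prodMk measurable_const)).aestronglyMeasurable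
  refine Integrable.mono' (hdom.const_mul C₀) hmeas ?_
  refine (ae_restrict_iff' measurableSet_Ioo).2 (Eventually.of_forall fun τ hτ => ?_)
  have h := hN (σ := 1 * (t - τ)) (by linarith [hτ.2]) (hu τ hτ) (hv τ hτ) x
  rw [one_mul] at h
  calc ‖oseenSlice (1 * (t - τ)) (u τ) (v τ) x‖
      ≤ C₀ * (t - τ) ^ (-(1 / 2 : ℝ)) * Mu τ * Mv τ := by simpa only [one_mul] using h
    _ = C₀ * ((t - τ) ^ (-(1 / 2 : ℝ)) * (Mu τ * Mv τ)) := by ring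

/-- Every slice `N_{t-τ}[u(τ), v(τ)]`, `τ < t`, of bounded measurable fields is differentiable.
[folklore] -/
theorem differentiable_oseenSlice_duhamel {u v : ℝ → E → E} (hum : Measurable (uncurry u))
    (hvm : Measurable (uncurry v)) {s t : ℝ} {Mu Mv : ℝ → ℝ}
    (hu : ∀ τ ∈ Ioo s t, ∀ y, ‖u τ y‖ ≤ Mu τ) (hv : ∀ τ ∈ Ioo s t, ∀ y, ‖v τ y‖ ≤ Mv τ)
    {τ : ℝ} (hτ : τ ∈ Ioo s t) : Differentiable ℝ (oseenSlice (1 * (t - τ)) (u τ) (v τ)) := by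
  have h1 : ContDiff ℝ 1 (oseenSlice (1 * (t - τ)) (u τ) (v τ)) :=
    contDiff_oseenSlice (by linarith [hτ.2]) (hum.comp (measurable_const.prodMk measurable_id))
      (hvm.comp (measurable_const.prodMk measurable_id)) (hu τ hτ) (hv τ hτ)
  exact h1.differentiable one_ne_zero

/-- **Differentiating the Duhamel term under the time integral.** If the slices of `u, v` are
bounded and measurable, the time integrand is dominated, and
`‖D N_{t-τ}[u(τ), v(τ)](x)‖ ≤ bound(τ)` for all `x` with `bound` integrable on `(s, t)`, then
`x ↦ B¹ₛ(u, v)(t)(x)` has the Fréchet derivative `∫_{(s,t)} D N_{t-τ}[u(τ), v(τ)](x₀) dτ` at every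
`x₀` (dominated differentiation under the integral sign; the measurability of the derivative in
`τ` is `measurable_fderiv_of_measurable_uncurry`). This is the justification of "`∇` inside the
time integral" in the proofs of Props. 4.2–4.3. [cite: CoiculescuPalasek2025, proofs of Props. 4.2–4.3 (the 𝒞^{1,κ} estimates of the Duhamel terms)] -/
theorem hasFDerivAt_oseenDuhamel {u v : ℝ → E → E} (hum : Measurable (uncurry u))
    (hvm : Measurable (uncurry v)) {s t : ℝ} {Mu Mv : ℝ → ℝ}
    (hu : ∀ τ ∈ Ioo s t, ∀ y, ‖u τ y‖ ≤ Mu τ) (hv : ∀ τ ∈ Ioo s t, ∀ y, ‖v τ y‖ ≤ Mv τ)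
    (hdom : IntegrableOn (fun τ => (t - τ) ^ (-(1 / 2 : ℝ)) * (Mu τ * Mv τ)) (Ioo s t) volume)
    {bound : ℝ → ℝ}
    (hb : ∀ τ ∈ Ioo s t, ∀ x, ‖fderiv ℝ (oseenSlice (1 * (t - τ)) (u τ) (v τ)) x‖ ≤ bound τ)
    (hbi : IntegrableOn bound (Ioo s t) volume) (x₀ : E) :
    HasFDerivAt (fun x => oseenDuhamel 1 s u v t x)
      (∫ τ in Ioo s t, fderiv ℝ (oseenSlice (1 * (t - τ)) (u τ) (v τ)) x₀) x₀ := by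
  set μ : Measure ℝ := volume.restrict (Ioo s t) with hμ
  have hSM := stronglyMeasurable_oseenSlice_duhamel 1 t hum hvm
  -- the family, extended by zero off `(s, t)` to be differentiable everywhere
  set g : ℝ → E → E := fun τ x => if τ ∈ Ioo s t then oseenSlice (1 * (t - τ)) (u τ) (v τ) x else 0
    with hg
  have hgm : Measurable (uncurry g) := by
    have heq : uncurry g = fun q : ℝ × E =>
        if q.1 ∈ Ioo s t then oseenSlice (1 * (t - q.1)) (u q.1) (v q.1) q.2 else 0 := by
      funext q; rfl
    rw [heq]
    exact Measurable.ite (measurableSet_Ioo.preimage measurable_fst) hSM.measurable measurable_const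
  have hgd : ∀ τ, DifferentiableAt ℝ (g τ) x₀ := by
    intro τ
    by_cases hτ : τ ∈ Ioo s t
    · have : g τ = oseenSlice (1 * (t - τ)) (u τ) (v τ) := by funext x; simp only [hg, if_pos hτ]
      rw [this]
      exact (differentiable_oseenSlice_duhamel hum hvm hu hv hτ) x₀
    · have : g τ = fun _ => 0 := by funext x; simp only [hg, if_neg hτ]
      rw [this]
      exact differentiableAt_const _
  have hF'm : AEStronglyMeasurable
      (fun τ => fderiv ℝ (oseenSlice (1 * (t - τ)) (u τ) (v τ)) x₀) μ := by
    have hm := measurable_fderiv_of_measurable_uncurry hgm hgd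
    refine (hm.aestronglyMeasurable.congr ?_)
    refine (ae_restrict_iff' measurableSet_Ioo).2 (Eventually.of_forall fun τ hτ => ?_)
    have : g τ = oseenSlice (1 * (t - τ)) (u τ) (v τ) := by funext x; simp only [hg, if_pos hτ]
    show fderiv ℝ (g τ) x₀ = fderiv ℝ (oseenSlice (1 * (t - τ)) (u τ) (v τ)) x₀
    rw [this]
  have key := hasFDerivAt_integral_of_dominated_of_fderiv_le (μ := μ) (𝕜 := ℝ) (x₀ := x₀)
    (s := univ) (F := fun x τ => oseenSlice (1 * (t - τ)) (u τ) (v τ) x)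
    (F' := fun x τ => fderiv ℝ (oseenSlice (1 * (t - τ)) (u τ) (v τ)) x) (bound := bound)
    univ_mem (Eventually.of_forall fun x =>
      (hSM.comp_measurable (measurable_id.prodMk measurable_const)).aestronglyMeasurable)
    (integrableOn_oseenSlice_of_dominated hum hvm hu hv hdom x₀) hF'm
    ((ae_restrict_iff' measurableSet_Ioo).2 (Eventually.of_forall fun τ hτ x _ => hb τ hτ x))
    hbi
    ((ae_restrict_iff' measurableSet_Ioo).2 (Eventually.of_forall fun τ hτ x _ =>
      ((differentiable_oseenSlice_duhamel hum hvm hu hv hτ) x).hasFDerivAt))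
  exact key

/-- **Sup bound of the derivative of the Duhamel term** from a slice-level bound:
`‖D B¹ₛ(u,v)(t)(x₀)‖ ≤ ∫_{(s,t)} bound`. [cite: CoiculescuPalasek2025, proofs of Props. 4.2–4.3] -/
theorem norm_fderiv_oseenDuhamel_le {u v : ℝ → E → E} (hum : Measurable (uncurry u))
    (hvm : Measurable (uncurry v)) {s t : ℝ} {Mu Mv : ℝ → ℝ}
    (hu : ∀ τ ∈ Ioo s t, ∀ y, ‖u τ y‖ ≤ Mu τ) (hv : ∀ τ ∈ Ioo s t, ∀ y, ‖v τ y‖ ≤ Mv τ)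
    (hdom : IntegrableOn (fun τ => (t - τ) ^ (-(1 / 2 : ℝ)) * (Mu τ * Mv τ)) (Ioo s t) volume)
    {bound : ℝ → ℝ}
    (hb : ∀ τ ∈ Ioo s t, ∀ x, ‖fderiv ℝ (oseenSlice (1 * (t - τ)) (u τ) (v τ)) x‖ ≤ bound τ)
    (hbi : IntegrableOn bound (Ioo s t) volume) (x₀ : E) :
    ‖fderiv ℝ (fun x => oseenDuhamel 1 s u v t x) x₀‖ ≤ ∫ τ in Ioo s t, bound τ := by
  rw [(hasFDerivAt_oseenDuhamel hum hvm hu hv hdom hb hbi x₀).fderiv]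
  exact norm_integral_le_of_norm_le hbi
    ((ae_restrict_iff' measurableSet_Ioo).2 (Eventually.of_forall fun τ hτ => hb τ hτ x₀))

/-- **Hölder bound of the derivative of the Duhamel term** from a slice-level Hölder bound:
`‖DB(x) - DB(x')‖ ≤ (∫_{(s,t)} h) ‖x - x'‖^κ` whenever `‖DN_{t-τ}[u,v](x) - DN_{t-τ}[u,v](x')‖ ≤
h(τ)‖x - x'‖^κ` with `h` integrable. [cite: CoiculescuPalasek2025, proofs of Props. 4.2–4.3 (the 𝒞^{1,κ} estimates)] -/
theorem norm_fderiv_oseenDuhamel_sub_le {u v : ℝ → E → E} (hum : Measurable (uncurry u))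
    (hvm : Measurable (uncurry v)) {s t : ℝ} {Mu Mv : ℝ → ℝ}
    (hu : ∀ τ ∈ Ioo s t, ∀ y, ‖u τ y‖ ≤ Mu τ) (hv : ∀ τ ∈ Ioo s t, ∀ y, ‖v τ y‖ ≤ Mv τ)
    (hdom : IntegrableOn (fun τ => (t - τ) ^ (-(1 / 2 : ℝ)) * (Mu τ * Mv τ)) (Ioo s t) volume)
    {bound : ℝ → ℝ}
    (hb : ∀ τ ∈ Ioo s t, ∀ x, ‖fderiv ℝ (oseenSlice (1 * (t - τ)) (u τ) (v τ)) x‖ ≤ bound τ)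
    (hbi : IntegrableOn bound (Ioo s t) volume)
    {h : ℝ → ℝ} {κ : ℝ}
    (hH : ∀ τ ∈ Ioo s t, ∀ x x', ‖fderiv ℝ (oseenSlice (1 * (t - τ)) (u τ) (v τ)) x -
      fderiv ℝ (oseenSlice (1 * (t - τ)) (u τ) (v τ)) x'‖ ≤ h τ * ‖x - x'‖ ^ κ)
    (hhi : IntegrableOn h (Ioo s t) volume) (x x' : E) :
    ‖fderiv ℝ (fun y => oseenDuhamel 1 s u v t y) x - fderiv ℝ (fun y => oseenDuhamel 1 s u v t y) x'‖ ≤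
      (∫ τ in Ioo s t, h τ) * ‖x - x'‖ ^ κ := by
  rw [(hasFDerivAt_oseenDuhamel hum hvm hu hv hdom hb hbi x).fderiv,
    (hasFDerivAt_oseenDuhamel hum hvm hu hv hdom hb hbi x').fderiv]
  have hSM := stronglyMeasurable_oseenSlice_duhamel 1 t hum hvm
  -- integrability of the derivative integrands
  have hint : ∀ z : E, IntegrableOn (fun τ => fderiv ℝ (oseenSlice (1 * (t - τ)) (u τ) (v τ)) z)
      (Ioo s t) volume := by
    intro z
    set g : ℝ → E → E := fun τ x =>
      if τ ∈ Ioo s t then oseenSlice (1 * (t - τ)) (u τ) (v τ) x else 0 with hg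
    have hgm : Measurable (uncurry g) := by
      have heq : uncurry g = fun q : ℝ × E =>
          if q.1 ∈ Ioo s t then oseenSlice (1 * (t - q.1)) (u q.1) (v q.1) q.2 else 0 := by
        funext q; rfl
      rw [heq]
      exact Measurable.ite (measurableSet_Ioo.preimage measurable_fst) hSM.measurable
        measurable_const
    have hgd : ∀ τ, DifferentiableAt ℝ (g τ) z := by
      intro τ
      by_cases hτ : τ ∈ Ioo s t
      · have : g τ = oseenSlice (1 * (t - τ)) (u τ) (v τ) := by funext x; simp only [hg, if_pos hτ]
        rw [this]
        exact (differentiable_oseenSlice_duhamel hum hvm hu hv hτ) z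
      · have : g τ = fun _ => 0 := by funext x; simp only [hg, if_neg hτ]
        rw [this]
        exact differentiableAt_const _
    have hm := measurable_fderiv_of_measurable_uncurry hgm hgd
    have hF'm : AEStronglyMeasurable (fun τ => fderiv ℝ (oseenSlice (1 * (t - τ)) (u τ) (v τ)) z)
        (volume.restrict (Ioo s t)) := by
      refine (hm.aestronglyMeasurable.congr ?_)
      refine (ae_restrict_iff' measurableSet_Ioo).2 (Eventually.of_forall fun τ hτ => ?_)
      have : g τ = oseenSlice (1 * (t - τ)) (u τ) (v τ) := by funext x; simp only [hg, if_pos hτ]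
      show fderiv ℝ (g τ) z = fderiv ℝ (oseenSlice (1 * (t - τ)) (u τ) (v τ)) z
      rw [this]
    exact Integrable.mono' hbi hF'm
      ((ae_restrict_iff' measurableSet_Ioo).2 (Eventually.of_forall fun τ hτ => hb τ hτ z))
  rw [← integral_sub (hint x) (hint x'), ← integral_mul_const]
  refine norm_integral_le_of_norm_le (hhi.mul_const _) ?_
  exact (ae_restrict_iff' measurableSet_Ioo).2 (Eventually.of_forall fun τ hτ => hH τ hτ x x')

/-- **Hölder modulus of the Duhamel term** from a slice-level Hölder modulus:
`‖B(x) - B(x')‖ ≤ (∫_{(s,t)} m)‖x - x'‖^γ`. [cite: CoiculescuPalasek2025, proof of Prop. 4.3 (w ∈ C⁰((0,1]; C^{1,κ}))] -/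
theorem norm_oseenDuhamel_sub_le {u v : ℝ → E → E} (hum : Measurable (uncurry u))
    (hvm : Measurable (uncurry v)) {s t : ℝ} {Mu Mv : ℝ → ℝ}
    (hu : ∀ τ ∈ Ioo s t, ∀ y, ‖u τ y‖ ≤ Mu τ) (hv : ∀ τ ∈ Ioo s t, ∀ y, ‖v τ y‖ ≤ Mv τ)
    (hdom : IntegrableOn (fun τ => (t - τ) ^ (-(1 / 2 : ℝ)) * (Mu τ * Mv τ)) (Ioo s t) volume)
    {m : ℝ → ℝ} {γ : ℝ}
    (hm : ∀ τ ∈ Ioo s t, ∀ x x', ‖oseenSlice (1 * (t - τ)) (u τ) (v τ) x -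
      oseenSlice (1 * (t - τ)) (u τ) (v τ) x'‖ ≤ m τ * ‖x - x'‖ ^ γ)
    (hmi : IntegrableOn m (Ioo s t) volume) (x x' : E) :
    ‖oseenDuhamel 1 s u v t x - oseenDuhamel 1 s u v t x'‖ ≤ (∫ τ in Ioo s t, m τ) * ‖x - x'‖ ^ γ := by
  have e : ∀ z, oseenDuhamel 1 s u v t z = ∫ τ in Ioo s t, oseenSlice (1 * (t - τ)) (u τ) (v τ) z :=
    fun z => rfl
  rw [e x, e x', ← integral_sub (integrableOn_oseenSlice_of_dominated hum hvm hu hv hdom x)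
    (integrableOn_oseenSlice_of_dominated hum hvm hu hv hdom x'), ← integral_mul_const]
  refine norm_integral_le_of_norm_le (hmi.mul_const _) ?_
  exact (ae_restrict_iff' measurableSet_Ioo).2 (Eventually.of_forall fun τ hτ => hm τ hτ x x')

end Duhamel

end Literature.Analysis.FluidPDE
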